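import Literature.NumberTheory.EllipticCurves.Wuthrich2014.PAdicBSDInequalityProofs
import HarnessLib

/-!
# Stein–Wuthrich 2013, Algorithm 11.1 / Proposition 11.2 (good ordinary `p ≥ 5`, any rank):
# `ord_p #Ш(E/ℚ)[p^∞] ≤ b_p` under surjective `ρ_{E,p}`, with equality under the main conjecture

`Proofs`-style file (theorems only; no new definition, no new named fact — D-0014/D-0026) for
W. Stein, C. Wuthrich, *Algorithms for the arithmetic of elliptic curves using Iwasawa theory*,
Math. Comp. 82 (2013) 1757–1792 (held author version `paper:url-055ad7d818a8`; "ms p. N" below),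
§11 "The algorithm for the Tate-Shafarevich group", in the GOOD ORDINARY case, EVERY rank `r`.
Written for the cell `b2b-bsdr2sha` (certified `Ш[p^∞]` for rank-`2` curves): these are the
Literature-level cores of the census row classes T0-reg / T1 of its PLAN §4; the Summits-side row
frames instantiate them with a kernel certificate of `ord_{T=0} L_p = r` (the observatory's
`Rank2ObservatoryPadicRow.rank_eq_and_order_eq_of_certificate`) and a certified regulator valuation.

AS PRINTED (ms p. 27 L25–p. 28 L15, Algorithm 11.1, conditions "p > 2, E does not have additive
reduction at p, the image of ρ̄_p is the full group GL₂(𝔽_p)"): "(3) … If the order of vanishing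
ord_{T=0} L_p(E,T) is equal to r … then we print that Ш(E/ℚ)(p) is finite … (4) … If p is a good
ordinary prime … let b_p = ord_p(L*_p(E,0)) − ord_p(ϵ_p) − Σ_υ ord_p(c_υ) − ord_p(Reg_γ(E/ℚ)).
(5) Output that #Ш(E/ℚ)(p) is bounded by p^{b_p}." Proof (ms p. 28 L16–L40): Theorem 6.1
(Schneider, Perrin-Riou) gives finiteness, non-degeneracy and
"ord_p(#Ш(E/ℚ)(p)) = ord_p(f*_E(0)) + ord_p((#E(ℚ)(p))²/(ϵ_p·∏_υ c_υ) · 1/Reg_γ(E/ℚ))", and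
"we use Kato's Theorem 7.3 that ord_p(f*_E(0)) ≤ ord_p(L*_p(E,0))". Proposition 11.2 (ms p. 28
L42–L47): "… If moreover the representation ρ̄_p is surjective, then the algorithm produces an upper
bound on #Ш(E/ℚ)(p). If Conjecture 7.1 holds then the result of the algorithm is equal to the order
of Ш(E/ℚ)(p)." Here `ϵ_p = (1 − 1/α)²` ((3.2), ms p. 9), `Reg_γ = Reg_p/log_p(κ(γ))^r` (§4.4, ms
p. 18), `κ(γ) = 1 + p = cyclotomicGenerator p`, `L*_p(E,0) = [T^r] L_p(E,T)`.

THE TREE'S INPUTS, BY NAME (nothing is re-vendored): Kato's Thm 7.3 = `kato_divisibility` clause (3)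
(Kato 2004 Thm 17.4 (3), integral divisibility under surjective `ρ_{E,p^∞}`; file `PAdicBSD`);
SW Thm 6.1 (good ordinary) = `Schneider1985_order_charGenerator` (Perrin-Riou / Schneider 1985 as
printed by Balakrishnan–Müller–Stein 2016 Thm 1.7; file `IwasawaLeadingTerm`, `p ≥ 5`, canonical
height datum `Dh.IsCanonical` = SW (4.1)); Conjecture 7.1 under the Skinner–Urban hypotheses =
`skinner_urban_main_conjecture` clause (3) (Invent. Math. 195 (2014) Thm 3.6.9 = SW Thm 7.5; file
`PAdicBSD`). Normalisation: the tree's `L_p = padicLFunction f α` is divided by `Ω⁺_f`, SW's by the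
Néron period `Ω_E`; the ratio `ϖ` (module docstring of `PAdicBSD`) is a `p`-adic unit when `E[p]` is
irreducible (which surjectivity implies), and Kato's clause (3) / S–U clause (3) are stated in the
tree for `padicLFunction f α` itself, so no `ϖ` appears below (contrast the reducible case,
`Wuthrich2014.padicBSD_inequality_of_charIdeal_dvd`, whose divisibility carries `ϖ`).

## Main statements (`W/ℚ` globally minimal elliptic, `p ≥ 5` good ordinary, `f` the newform,
`L = padicLFunction f (unitRoot W p)`, `r = rank_ℤ E(ℚ)`, `Dh` THE canonical height datum)

* `padicValNat_sha_le_of_surjective` — **SW13 Algorithm 11.1 / Prop. 11.2, upper bound**: Kato (all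
  cyclotomic data) + PRS + `ρ_{E,p^n}` surjective for all `n` + `ord_{T=0} L = r` ⇒ `Ш(E/ℚ)[p^∞]`
  finite, `Reg_p(E,Dh) ≠ 0`, and
  `ord_p #Ш[p^∞] + ord_p((1−α⁻¹)²·Reg_p·∏c_ℓ) ≤ ord_p([T^r]L · log_p(γ_cyc)^r · #E(ℚ)_tors²)`
  (i.e. `ord_p #Ш[p^∞] ≤ b_p`, denominators cleared as in `PAdicBSDConjecture`).
* `padicValNat_sha_eq_of_mainConjecture` — **SW13 Prop. 11.2, last sentence ("If Conjecture 7.1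
  holds …")** with Conjecture 7.1 supplied by Skinner–Urban: S–U (all cyclotomic data) + PRS +
  irreducible + ramified prime `ℓ ‖ N`, `p ∤ v_ℓ(Δ)` + surjective + `ord_{T=0} L = r` ⇒ finiteness,
  non-degeneracy and EQUALITY of the two valuations (`ord_p #Ш[p^∞] = b_p`).

Proof of the bound (SW p. 28): `L = ι(g)`, `g ∈ char X = (f_E)`, so `g = h·f_E` with `h ∈ Λ`;
PRS clause 1 gives `f_E = T^r·q`; comparing `T^r`-coefficients, `[T^r]L = h(0)·q(0)` with
`[T^r]L ≠ 0` (from `ord L = r`), so `ord_T f_E = r`, whence (PRS clause 2) `Ш[p^∞]` finite and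
`Reg_p ≠ 0`, and (PRS clause 3) `q(0)·log^r·tors² = u·ε·#Ш·Reg·∏c`; `ord_p h(0) ≥ 0` is the
inequality. Under S–U clause (3) one may take `f_E = g` with `ι g = L`, so `h = 1` and equality holds.

References: [SteinWuthrich2013] §11 Algorithm 11.1, Prop. 11.2 (ms pp. 27–28), Thm 6.1 (ms p. 20),
Thm 7.3 / 7.5 (ms p. 22); [Kato2004Asterisque] Thm 17.4; [SkinnerUrban2014] Thm 3.6.9;
[BalakrishnanMullerStein2015] Thm 1.7.
-/

set_option autoImplicit false

noncomputable section

open scoped Classical MatrixGroups ModularForm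

open CongruenceSubgroup WeierstrassCurve Literature.NumberTheory.EllipticCurves
  Literature.NumberTheory.EllipticCurves.ModularForms

open Literature.NumberTheory.EllipticCurves.Wuthrich2014 (coeff_iwasawaToPowerSeries)

namespace Literature.NumberTheory.EllipticCurves.SteinWuthrich2013

/-- **The leading-term comparison behind SW13 Algorithm 11.1** (internal lemma, any rank): if
`ι g = L_p` for some `g = h · f_E` in `char_Λ X = (f_E)` (`h ∈ Λ`), PRS holds and
`ord_{T=0} L_p = r = rank`, then `Ш[p^∞]` is finite, `Reg_p ≠ 0`, and
`[T^r]L · log^r · tors² = h(0) · (u · ε · #Ш[p^∞] · Reg · ∏c)` for a unit `u`, with `h(0) ∈ ℤ_p`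
non-zero. [cite: SteinWuthrich2013, §11 proof of Algorithm 11.1 (ms p. 28)]
[cite: BalakrishnanMullerStein2015, Thm. 1.7] -/
theorem leadingTerm_eq_mul_of_generator_dvd (hS : Schneider1985_order_charGenerator)
    (W : WeierstrassCurve ℚ) [W.IsElliptic] [W.IsGloballyMinimal] (p : ℕ) [Fact p.Prime]
    (hp : 5 ≤ p) (hgood : W.HasGoodReductionAtPrime p) (hordp : ¬ (p : ℤ) ∣ W.frobeniusTrace p)
    {N : ℕ} [NeZero N] {f : CuspForm (Gamma0 N) 2}
    {κ : ZpExtension ℚ p} {γ : Field.absoluteGaloisGroup ℚ} (hκ : κ.IsCyclotomic)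
    (hγ : κ.IsTopGenerator γ) (hγ' : IsCyclotomicVariable p γ)
    (D : W.SelmerDualData κ γ) [Module.Finite (IwasawaAlgebra p) D.X] (hX : D.IsTorsion)
    {fE h : IwasawaAlgebra p} (hchar : D.charIdeal = Ideal.span {fE})
    (hιg : iwasawaToPowerSeries p (h * fE) = padicLFunction f (unitRoot W p : ℚ_[p]))
    (Dh : PAdicHeightData W p) (hDh : Dh.IsCanonical)
    (hord : (padicLFunction f (unitRoot W p : ℚ_[p])).order = W.mordellWeilRank) :
    Finite (AddCommGroup.primaryComponent W.sha p) ∧ SchneiderConjecture Dh ∧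
      PowerSeries.constantCoeff h ≠ 0 ∧
      ∃ u : ℤ_[p]ˣ,
        PowerSeries.coeff W.mordellWeilRank (padicLFunction f (unitRoot W p : ℚ_[p])) *
            padicLog p (cyclotomicGenerator p) ^ W.mordellWeilRank * (W.torsionOrder : ℚ_[p]) ^ 2 =
          ((PowerSeries.constantCoeff h : ℤ_[p]) : ℚ_[p]) *
            (((u : ℤ_[p]) : ℚ_[p]) * ((1 - (unitRoot W p : ℚ_[p])⁻¹) ^ 2 *
              ((Nat.card (AddCommGroup.primaryComponent W.sha p) : ℚ_[p]) *
                padicRegulator Dh * W.tamagawaProduct))) := by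
  set r := W.mordellWeilRank with hr_def
  set L := padicLFunction f (unitRoot W p : ℚ_[p]) with hL_def
  -- PRS clause 1: `T^r ∣ fE`, so `fE = T^r · q`
  obtain ⟨q, hq⟩ := Schneider1985_order_charGenerator.X_pow_dvd hS hp hgood hordp hκ hγ hγ' D hX hchar hDh
  -- coefficients at `T^r`
  have hcoeffL : PowerSeries.coeff r L ≠ 0 := by
    have hL0 : L ≠ 0 := by
      intro h0
      rw [h0, PowerSeries.order_zero] at hord
      exact ENat.top_ne_coe _ hord
    have h1 := PowerSeries.coeff_order hL0
    rwa [hord, ENat.toNat_coe] at h1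
  have hcoeff_g : (PowerSeries.coeff r (h * fE) : ℤ_[p]) =
      PowerSeries.constantCoeff h * PowerSeries.constantCoeff q := by
    rw [hq, show h * (PowerSeries.X ^ r * q) = PowerSeries.X ^ r * (h * q) by ring,
      PowerSeries.coeff_X_pow_mul', if_pos le_rfl, Nat.sub_self,
      PowerSeries.coeff_zero_eq_constantCoeff, map_mul]
  have hcoeff_fE : (PowerSeries.coeff r fE : ℤ_[p]) = PowerSeries.constantCoeff q := by
    rw [hq, PowerSeries.coeff_X_pow_mul', if_pos le_rfl, Nat.sub_self,
      PowerSeries.coeff_zero_eq_constantCoeff]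
  have hcoeff_ιg : ((PowerSeries.coeff r (h * fE) : ℤ_[p]) : ℚ_[p]) = PowerSeries.coeff r L := by
    rw [← coeff_iwasawaToPowerSeries p (h * fE) r, hιg]
  have hg_r_ne : (PowerSeries.coeff r (h * fE) : ℤ_[p]) ≠ 0 := by
    intro h0
    have : ((PowerSeries.coeff r (h * fE) : ℤ_[p]) : ℚ_[p]) = 0 := by rw [h0]; rfl
    rw [hcoeff_ιg] at this
    exact hcoeffL this
  have hh0 : PowerSeries.constantCoeff h ≠ 0 := by
    intro h0; apply hg_r_ne; rw [hcoeff_g, h0, zero_mul]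
  have hq0 : PowerSeries.constantCoeff q ≠ 0 := by
    intro h0; apply hg_r_ne; rw [hcoeff_g, h0, mul_zero]
  -- `ord_T fE = r`
  have hordfE : fE.order = r := by
    refine le_antisymm (PowerSeries.order_le r (by rw [hcoeff_fE]; exact hq0)) ?_
    exact Schneider1985_order_charGenerator.mordellWeilRank_le_order hS hp hgood hordp hκ hγ hγ' D hX
      hchar hDh
  -- PRS clauses 2 and 3
  obtain ⟨hSch, hfin⟩ := (Schneider1985_order_charGenerator.order_eq_iff hS hp hgood hordp hκ hγ hγ'
    D hX hchar hDh).mp hordfE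
  obtain ⟨u, hu⟩ := Schneider1985_order_charGenerator.leadingCoeff hS hp hgood hordp hκ hγ hγ' D hX
    hchar hDh hSch hfin
  refine ⟨hfin, hSch, hh0, u, ?_⟩
  have e1 : PowerSeries.coeff r L =
      ((PowerSeries.constantCoeff h : ℤ_[p]) : ℚ_[p]) * ((PowerSeries.coeff r fE : ℤ_[p]) : ℚ_[p]) := by
    rw [← hcoeff_ιg, hcoeff_g, hcoeff_fE]; push_cast; ring
  calc PowerSeries.coeff r L * padicLog p (cyclotomicGenerator p) ^ r * (W.torsionOrder : ℚ_[p]) ^ 2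
      = ((PowerSeries.constantCoeff h : ℤ_[p]) : ℚ_[p]) *
          (((PowerSeries.coeff r fE : ℤ_[p]) : ℚ_[p]) * padicLog p (cyclotomicGenerator p) ^ r *
            (W.torsionOrder : ℚ_[p]) ^ 2) := by rw [e1]; ring
    _ = _ := by rw [hu]

/-- **Valuation bookkeeping** (internal lemma): from
`[T^r]L · log^r · tors² = h(0) · (u · ε · #Ш · Reg · ∏c)` with `h(0) ∈ ℤ_p ∖ {0}`, `u` a unit and
`Reg ≠ 0`, `Ш[p^∞]` finite, deduce
`ord_p #Ш + ord_p(ε · Reg · ∏c) + ord_p h(0) = ord_p([T^r]L · log^r · tors²)` with `ord_p h(0) ≥ 0`.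
[cite: SteinWuthrich2013, §11 proof of Algorithm 11.1 (ms p. 28)] -/
theorem valuation_eq_of_leadingTerm_eq_mul
    (W : WeierstrassCurve ℚ) [W.IsElliptic] [W.IsGloballyMinimal] (p : ℕ) [Fact p.Prime]
    (hord : IsOrdinaryAt W p) {N : ℕ} [NeZero N] {f : CuspForm (Gamma0 N) 2}
    (Dh : PAdicHeightData W p) (hSch : SchneiderConjecture Dh)
    [Finite (AddCommGroup.primaryComponent W.sha p)]
    {h0 : ℤ_[p]} (hh0 : h0 ≠ 0) (u : ℤ_[p]ˣ)
    (key : PowerSeries.coeff W.mordellWeilRank (padicLFunction f (unitRoot W p : ℚ_[p])) *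
        padicLog p (cyclotomicGenerator p) ^ W.mordellWeilRank * (W.torsionOrder : ℚ_[p]) ^ 2 =
      ((h0 : ℤ_[p]) : ℚ_[p]) *
        (((u : ℤ_[p]) : ℚ_[p]) * ((1 - (unitRoot W p : ℚ_[p])⁻¹) ^ 2 *
          ((Nat.card (AddCommGroup.primaryComponent W.sha p) : ℚ_[p]) *
            padicRegulator Dh * W.tamagawaProduct)))) :
    (padicValNat p (Nat.card (AddCommGroup.primaryComponent W.sha p)) : ℤ) +
        ((1 - (unitRoot W p : ℚ_[p])⁻¹) ^ 2 * (padicRegulator Dh * W.tamagawaProduct)).valuation +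
        ((h0 : ℤ_[p]) : ℚ_[p]).valuation =
      (PowerSeries.coeff W.mordellWeilRank (padicLFunction f (unitRoot W p : ℚ_[p])) *
        padicLog p (cyclotomicGenerator p) ^ W.mordellWeilRank * (W.torsionOrder : ℚ_[p]) ^ 2).valuation ∧
      0 ≤ ((h0 : ℤ_[p]) : ℚ_[p]).valuation := by
  set H : ℚ_[p] := ((h0 : ℤ_[p]) : ℚ_[p]) with hH_def
  set ε : ℚ_[p] := (1 - (unitRoot W p : ℚ_[p])⁻¹) ^ 2 with hε_def
  set Shp : ℚ_[p] := (Nat.card (AddCommGroup.primaryComponent W.sha p) : ℚ_[p]) with hShp_def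
  set RegC : ℚ_[p] := padicRegulator Dh * W.tamagawaProduct with hRegC_def
  have hHne : H ≠ 0 := by
    rw [hH_def]; intro e; exact hh0 (by exact_mod_cast (PadicInt.coe_eq_zero.mp e))
  have hHval : 0 ≤ H.valuation := by rw [hH_def]; exact PadicInt.valuation_coe_nonneg
  obtain ⟨u₂, hu₂⟩ := exists_unit_one_sub_unitRoot_inv p W hord
  have hε0 : ε ≠ 0 := by
    rw [hε_def, hu₂]
    refine pow_ne_zero 2 (mul_ne_zero (coe_units_ne_zero p u₂) ?_)
    exact_mod_cast (W.reductionPointCount_pos p).ne'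
  have hShp0 : Shp ≠ 0 := by rw [hShp_def]; exact_mod_cast Nat.card_pos.ne'
  have hc0 : (W.tamagawaProduct : ℚ_[p]) ≠ 0 := by
    exact_mod_cast (W.tamagawaProduct_pos_holds : 0 < W.tamagawaProduct).ne'
  have hRegC0 : RegC ≠ 0 := by rw [hRegC_def]; exact mul_ne_zero hSch hc0
  have hrhs0 : ((u : ℤ_[p]) : ℚ_[p]) * (ε * (Shp * RegC)) ≠ 0 :=
    mul_ne_zero (coe_units_ne_zero p u) (mul_ne_zero hε0 (mul_ne_zero hShp0 hRegC0))
  have key' : PowerSeries.coeff W.mordellWeilRank (padicLFunction f (unitRoot W p : ℚ_[p])) *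
        padicLog p (cyclotomicGenerator p) ^ W.mordellWeilRank * (W.torsionOrder : ℚ_[p]) ^ 2 =
      H * (((u : ℤ_[p]) : ℚ_[p]) * (ε * (Shp * RegC))) := by
    rw [key, hRegC_def, ← mul_assoc (Shp)]
  have hval := congrArg Padic.valuation key'
  rw [Padic.valuation_mul hHne hrhs0, Padic.valuation_mul (coe_units_ne_zero p u)
      (mul_ne_zero hε0 (mul_ne_zero hShp0 hRegC0)), valuation_coe_units_eq_zero, zero_add,
    Padic.valuation_mul hε0 (mul_ne_zero hShp0 hRegC0), Padic.valuation_mul hShp0 hRegC0] at hval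
  have hvS : Shp.valuation = (padicValNat p (Nat.card (AddCommGroup.primaryComponent W.sha p)) : ℤ) := by
    rw [hShp_def, Padic.valuation_natCast]
  have hεR : (ε * RegC).valuation = ε.valuation + RegC.valuation := Padic.valuation_mul hε0 hRegC0
  refine ⟨?_, hHval⟩
  rw [show (1 - (unitRoot W p : ℚ_[p])⁻¹) ^ 2 * (padicRegulator Dh * W.tamagawaProduct) = ε * RegC
    from rfl, hεR, ← hvS, hval]
  ring

/-- **Stein–Wuthrich 2013, Algorithm 11.1 (steps 3–5) and Proposition 11.2 — the upper bound, good
ordinary `p ≥ 5`, any rank, surjective `ρ_{E,p}`.** Let `W` be a globally minimal model of `E/ℚ`,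
`p ≥ 5` a prime of good ordinary reduction (`hord`), `f` the newform of `E` (`hf`),
`L = L_p(E,T) = padicLFunction f α` (`α = unitRoot W p`), `r = rank_ℤ E(ℚ)`, `Dh` THE canonical
`p`-adic height datum (`hDh`, SW (4.1)). ASSUME, as named hypotheses: Kato's theorem for all
cyclotomic data (`hkato`, Kato 2004 Thm 17.4 = SW Thm 7.3/7.4), the Perrin-Riou–Schneider theorem
(`hS`, SW Thm 6.1), surjectivity of `ρ_{E,p} : Γ_ℚ → GL₂(ℤ_p)` spelled as surjectivity mod `p^n` for
all `n` (`hsurj`; for `p ≥ 5` equivalent to `ρ̄_{E,p}` surjective, SW Prop. 7.2), and the computed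
order of vanishing `ord_{T=0} L = r` (`hordL`, Algorithm 11.1 step 3). THEN (SW p. 28, proof of
Algorithm 11.1): `Ш(E/ℚ)[p^∞]` is finite, the canonical `p`-adic height is non-degenerate
(`Reg_p(E, Dh) ≠ 0`, Conjecture 4.1 at `(E,p)`), and
`ord_p #Ш(E/ℚ)[p^∞] + ord_p((1 − α⁻¹)² · Reg_p(E,Dh) · ∏_ℓ c_ℓ) ≤ ord_p([T^r]L · log_p(γ_cyc)^r · (#E(ℚ)_tors)²)`,
i.e. `ord_p #Ш(E/ℚ)(p) ≤ b_p = ord_p L*_p(E,0) − ord_p ϵ_p − Σ ord_p c_υ − ord_p Reg_γ(E/ℚ)`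
(`Reg_γ = Reg_p / log_p(1+p)^r`; `#E(ℚ)(p) = 1` under surjectivity, SW p. 28 L35, but the torsion
term is kept, as PRS prints it). As printed: "(5) Output that #Ш(E/ℚ)(p) is bounded by p^{b_p}."
[cite: SteinWuthrich2013, Algorithm 11.1 and Prop. 11.2 (ms pp. 27–28)]
[cite: Kato2004Asterisque, Thm. 17.4 (p. 273)] [cite: BalakrishnanMullerStein2015, Thm. 1.7] -/
theorem padicValNat_sha_le_of_surjective (hS : Schneider1985_order_charGenerator)
    (W : WeierstrassCurve ℚ) [W.IsElliptic] [W.IsGloballyMinimal] (p : ℕ) [Fact p.Prime]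
    (hp : 5 ≤ p) (hord : IsOrdinaryAt W p)
    {N : ℕ} [NeZero N] {f : CuspForm (Gamma0 N) 2} (hf : IsNewformOf W f)
    (hkato : ∀ (κ : ZpExtension ℚ p) (γ : Field.absoluteGaloisGroup ℚ),
      kato_divisibility W p (κ := κ) (γ := γ) (f := f))
    (hsurj : ∀ n : ℕ, W.HasSurjectiveModNGaloisRep (p ^ n : ℕ))
    (Dh : PAdicHeightData W p) (hDh : Dh.IsCanonical)
    (hordL : (padicLFunction f (unitRoot W p : ℚ_[p])).order = W.mordellWeilRank) :
    Finite (AddCommGroup.primaryComponent W.sha p) ∧ SchneiderConjecture Dh ∧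
      (padicValNat p (Nat.card (AddCommGroup.primaryComponent W.sha p)) : ℤ) +
          ((1 - (unitRoot W p : ℚ_[p])⁻¹) ^ 2 * (padicRegulator Dh * W.tamagawaProduct)).valuation ≤
        (PowerSeries.coeff W.mordellWeilRank (padicLFunction f (unitRoot W p : ℚ_[p])) *
          padicLog p (cyclotomicGenerator p) ^ W.mordellWeilRank * (W.torsionOrder : ℚ_[p]) ^ 2).valuation := by
  have hp2 : p ≠ 2 := by omega
  -- the cyclotomic setting, the Iwasawa module, Kato's integral divisibility under surjectivity
  obtain ⟨κ, hκ, γ, hγ, hγ'⟩ := exists_isCyclotomic_isTopGenerator_isCyclotomicVariable_holds p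
  obtain ⟨D⟩ := W.nonempty_selmerDualData_holds κ γ hγ
  haveI : Module.Finite (IwasawaAlgebra p) D.X := D.module_finite_holds hγ
  obtain ⟨hX, -, hint⟩ := hkato κ γ hp2 hord hκ hγ hγ' hf D
  obtain ⟨g, hgmem, hιg⟩ := hint hsurj
  -- a generator `fE` of `char X` and the cofactor `h`
  haveI : (Module.charIdeal (IwasawaAlgebra p) D.X).IsPrincipal := charIdeal_isPrincipal_holds p D.X
  obtain ⟨fE, hchar⟩ := Submodule.IsPrincipal.principal (Module.charIdeal (IwasawaAlgebra p) D.X)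
  have hchar' : D.charIdeal = Ideal.span {fE} := hchar
  have hgmem' : g ∈ Ideal.span {fE} := by rw [← hchar']; exact hgmem
  obtain ⟨h, hgh⟩ := Ideal.mem_span_singleton'.mp hgmem'
  rw [← hgh] at hιg
  obtain ⟨hfin, hSch, hh0, u, key⟩ := leadingTerm_eq_mul_of_generator_dvd hS W p hp hord.1 hord.2
    hκ hγ hγ' D hX hchar' hιg Dh hDh hordL
  haveI := hfin
  obtain ⟨hval, hnonneg⟩ := valuation_eq_of_leadingTerm_eq_mul W p hord Dh hSch hh0 u key
  refine ⟨hfin, hSch, ?_⟩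
  linarith

/-- **Stein–Wuthrich 2013, Proposition 11.2, last sentence — equality under the main conjecture
(Skinner–Urban), good ordinary `p ≥ 5`, any rank.** Same setting as
`padicValNat_sha_le_of_surjective`; ASSUME instead of Kato's theorem the Skinner–Urban main
conjecture for all cyclotomic data (`hSU`, Invent. Math. 195 (2014) Thm 3.6.9 = SW Thm 7.5: needs
`ρ̄_{E,p}` irreducible (`hirr`) and a prime `ℓ ≠ p` of multiplicative reduction with `p ∤ v_ℓ(Δ_min)`,
i.e. `ρ̄_{E,p}` ramified at `ℓ` (`haux`; SW p. 22 L36–L41); its integral clause (3) needs `ρ_{E,p}`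
surjective (`hsurj`)), PRS (`hS`), and `ord_{T=0} L = r` (`hordL`). THEN `Ш(E/ℚ)[p^∞]` is finite,
`Reg_p(E,Dh) ≠ 0`, and
`ord_p #Ш(E/ℚ)[p^∞] + ord_p((1 − α⁻¹)² · Reg_p(E,Dh) · ∏_ℓ c_ℓ) = ord_p([T^r]L · log_p(γ_cyc)^r · (#E(ℚ)_tors)²)`,
i.e. `#Ш(E/ℚ)(p) = p^{b_p}`. As printed: "If Conjecture 7.1 holds then the result of the algorithm
is equal to the order of Ш(E/ℚ)(p)" (SW p. 28 L46–L47); "if the conditions of Theorem 7.5 are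
satisfied for p, then we have the equality" (SW p. 24 L13–L15, rank 0).
[cite: SteinWuthrich2013, Prop. 11.2 (ms p. 28) and Thm. 7.5 (ms p. 22)]
[cite: SkinnerUrban2014, Thm. 3.6.9 (p. 45)] [cite: BalakrishnanMullerStein2015, Thm. 1.7] -/
theorem padicValNat_sha_eq_of_mainConjecture (hS : Schneider1985_order_charGenerator)
    (W : WeierstrassCurve ℚ) [W.IsElliptic] [W.IsGloballyMinimal] (p : ℕ) [Fact p.Prime]
    (hp : 5 ≤ p) (hord : IsOrdinaryAt W p) (hirr : W.HasIrreducibleModPGaloisRep p)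
    (haux : ∃ ℓ : ℕ, ∃ _ : Fact ℓ.Prime, ℓ ≠ p ∧ W.HasMultiplicativeReductionAtPrime ℓ ∧
      ¬ p ∣ padicValInt ℓ W.minimalDiscriminantInt)
    {N : ℕ} [NeZero N] {f : CuspForm (Gamma0 N) 2} (hf : IsNewformOf W f)
    (hSU : ∀ (κ : ZpExtension ℚ p) (γ : Field.absoluteGaloisGroup ℚ),
      skinner_urban_main_conjecture W p (κ := κ) (γ := γ) (f := f))
    (hsurj : ∀ n : ℕ, W.HasSurjectiveModNGaloisRep (p ^ n : ℕ))
    (Dh : PAdicHeightData W p) (hDh : Dh.IsCanonical)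
    (hordL : (padicLFunction f (unitRoot W p : ℚ_[p])).order = W.mordellWeilRank) :
    Finite (AddCommGroup.primaryComponent W.sha p) ∧ SchneiderConjecture Dh ∧
      (padicValNat p (Nat.card (AddCommGroup.primaryComponent W.sha p)) : ℤ) +
          ((1 - (unitRoot W p : ℚ_[p])⁻¹) ^ 2 * (padicRegulator Dh * W.tamagawaProduct)).valuation =
        (PowerSeries.coeff W.mordellWeilRank (padicLFunction f (unitRoot W p : ℚ_[p])) *
          padicLog p (cyclotomicGenerator p) ^ W.mordellWeilRank * (W.torsionOrder : ℚ_[p]) ^ 2).valuation := by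
  have hp3 : 3 ≤ p := by omega
  obtain ⟨κ, hκ, γ, hγ, hγ'⟩ := exists_isCyclotomic_isTopGenerator_isCyclotomicVariable_holds p
  obtain ⟨D⟩ := W.nonempty_selmerDualData_holds κ γ hγ
  haveI : Module.Finite (IwasawaAlgebra p) D.X := D.module_finite_holds hγ
  obtain ⟨hX, -, h3⟩ := hSU κ γ hp3 hord.1 hord.2 hirr haux hκ hγ hγ' hf D
  obtain ⟨g, hιg, hchar⟩ := h3 hsurj
  -- take `fE = g`, cofactor `h = 1`
  have hιg' : iwasawaToPowerSeries p (1 * g) = padicLFunction f (unitRoot W p : ℚ_[p]) := by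
    rw [one_mul]; exact hιg
  obtain ⟨hfin, hSch, hh0, u, key⟩ := leadingTerm_eq_mul_of_generator_dvd hS W p hp hord.1 hord.2
    hκ hγ hγ' D hX hchar hιg' Dh hDh hordL
  haveI := hfin
  obtain ⟨hval, -⟩ := valuation_eq_of_leadingTerm_eq_mul W p hord Dh hSch hh0 u key
  refine ⟨hfin, hSch, ?_⟩
  have h1 : (((PowerSeries.constantCoeff (1 : IwasawaAlgebra p) : ℤ_[p]) : ℚ_[p])).valuation = 0 := by
    rw [map_one, PadicInt.coe_one, Padic.valuation_one]
  rw [h1, add_zero] at hval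
  exact hval

/-- **Corollary (census row class T0 of `b2b-bsdr2sha`: `Ш(E/ℚ)[p^∞] = 0`)** under the hypotheses
of `padicValNat_sha_le_of_surjective`: if the certified analytic exponent vanishes,
`ord_p([T^r]L · log_p(γ_cyc)^r · #E(ℚ)_tors²) = ord_p((1 − α⁻¹)² · Reg_p · ∏c_ℓ)` (`b_p = 0`), then
`#Ш(E/ℚ)[p^∞] = 1` — Kato's divisibility alone suffices, no Skinner–Urban hypothesis (SW13 §12.4,
ms p. 31: "our hypotheses on p then imply that Ш(E/ℚ)[p] = 0"; and p. 29 L5–L13: the main conjecture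
for `(E,p)` then follows as a by-product, not asserted here).
[cite: SteinWuthrich2013, §12.4 (ms p. 31) and Algorithm 11.1 (ms pp. 27–28)] -/
theorem natCard_sha_eq_one_of_surjective (hS : Schneider1985_order_charGenerator)
    (W : WeierstrassCurve ℚ) [W.IsElliptic] [W.IsGloballyMinimal] (p : ℕ) [Fact p.Prime]
    (hp : 5 ≤ p) (hord : IsOrdinaryAt W p)
    {N : ℕ} [NeZero N] {f : CuspForm (Gamma0 N) 2} (hf : IsNewformOf W f)
    (hkato : ∀ (κ : ZpExtension ℚ p) (γ : Field.absoluteGaloisGroup ℚ),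
      kato_divisibility W p (κ := κ) (γ := γ) (f := f))
    (hsurj : ∀ n : ℕ, W.HasSurjectiveModNGaloisRep (p ^ n : ℕ))
    (Dh : PAdicHeightData W p) (hDh : Dh.IsCanonical)
    (hordL : (padicLFunction f (unitRoot W p : ℚ_[p])).order = W.mordellWeilRank)
    (hbp : (PowerSeries.coeff W.mordellWeilRank (padicLFunction f (unitRoot W p : ℚ_[p])) *
          padicLog p (cyclotomicGenerator p) ^ W.mordellWeilRank * (W.torsionOrder : ℚ_[p]) ^ 2).valuation =
        ((1 - (unitRoot W p : ℚ_[p])⁻¹) ^ 2 * (padicRegulator Dh * W.tamagawaProduct)).valuation) :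
    Finite (AddCommGroup.primaryComponent W.sha p) ∧
      Nat.card (AddCommGroup.primaryComponent W.sha p) = 1 := by
  obtain ⟨hfin, -, hle⟩ := padicValNat_sha_le_of_surjective hS W p hp hord hf hkato hsurj Dh hDh hordL
  haveI := hfin
  refine ⟨hfin, ?_⟩
  have hv0 : padicValNat p (Nat.card (AddCommGroup.primaryComponent W.sha p)) = 0 := by
    have : (padicValNat p (Nat.card (AddCommGroup.primaryComponent W.sha p)) : ℤ) ≤ 0 := by
      linarith
    omega
  -- a finite `p`-primary group of order prime to `p` is trivial
  have hcard_pos : 0 < Nat.card (AddCommGroup.primaryComponent W.sha p) := Nat.card_pos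
  by_contra hne
  have hlt : 1 < Nat.card (AddCommGroup.primaryComponent W.sha p) := by omega
  -- there is a non-zero element, of order `p^k` with `k ≥ 1`, so `p ∣ #Ш[p^∞]`
  haveI : Fintype (AddCommGroup.primaryComponent W.sha p) := Fintype.ofFinite _
  have hnt : Nontrivial (AddCommGroup.primaryComponent W.sha p) := by
    rw [← Finite.one_lt_card_iff_nontrivial]; exact hlt
  obtain ⟨x, hx⟩ := exists_ne (0 : AddCommGroup.primaryComponent W.sha p)
  obtain ⟨k, hk⟩ := (AddCommGroup.mem_primaryComponent_iff_addOrderOf (G := W.sha) (p := p)).mp x.2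
  have hk' : addOrderOf x = p ^ k := by
    rw [← addOrderOf_injective (AddCommGroup.primaryComponent W.sha p).subtype Subtype.coe_injective x]
    exact hk
  have hk1 : k ≠ 0 := by
    rintro rfl
    rw [pow_zero, AddMonoid.addOrderOf_eq_one_iff] at hk'
    exact hx hk'
  have hdvd : p ∣ Nat.card (AddCommGroup.primaryComponent W.sha p) := by
    have h1 : addOrderOf x ∣ Nat.card (AddCommGroup.primaryComponent W.sha p) := addOrderOf_dvd_natCard x
    rw [hk'] at h1
    exact (dvd_pow_self p hk1).trans h1
  have hpv : 0 < padicValNat p (Nat.card (AddCommGroup.primaryComponent W.sha p)) :=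
    one_le_padicValNat_of_dvd hcard_pos.ne' hdvd
  omega

end Literature.NumberTheory.EllipticCurves.SteinWuthrich2013

end
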